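import Mathlib
import Literature.NumberTheory.LFunctions.Zhang2022.TypedSection15CRel
import Literature.NumberTheory.LFunctions.Zhang2022.Section15U056RateRel
import HarnessLib

/-!
# Zhang (2022) §15 p. 88: the u056 → (15.23) → (15.24) chain over the AMENDED relative u055
# (`Step15_u055RelS`: sup-hypotheses on the continuation `U`)

Topic `Literature/NumberTheory/LFunctions/Zhang2022` (Landau–Siegel audit tree; verdict-neutral).
Y. Zhang, *Discrete mean estimates and the Landau–Siegel zero*, arXiv:2211.02515v1 (2022)
[Zhang2022LandauSiegel] — an unrefereed manuscript under adjudication; nothing here asserts or denies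
its Theorems 1–2. Fifth twin of `Section15U056Rate` / `…RateR` / `…RateRp` / `…RateRel` (lane ZHANG-L,
WP15, ruling R-34 / RT-07 amended): the u055 input enters in the reading of record
`Typed.Section15C.Step15_u055RelS` — "`‖Σ_{n<T} − L′(1,χ)²U(1)‖ ≤ C·α𝓛³·((1+|L′(1,χ)|)²·S + 1)` for
every `S` bounding `‖U‖` on the disc `‖s−1‖ ≤ 1/𝓛` and, up to the factor `e^{2𝓛^{1/10}}`, on the
half-plane `Re s ≥ 9/10`". The chain still closes at the rate `O(1/𝓛)` because such an `S` of size
`O(𝓛)` is available: the half-plane bound is Lemma 15.3 in its reading of record (`Lemma153Rp`), the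
near-`1` bound `‖U(s)‖ ≤ C₇𝓛` (`‖s−1‖ ≤ 1/𝓛`) is one extra hypothesis (supplied by the Euler-product
files of the `calU1R` object), and the two continuations coincide by the identity theorem
(`isCalU1R_eqOn`); then `α𝓛³·((1+|L′|)²·S + 1) ≤ C·𝓛^{−9+3+4+1} = C/𝓛`
(`‖L′(1,χ)‖ ≤ 4e^{9/2}𝓛²`, `Lemma31.norm_deriv_LFunction_le_near_one`).

* `isCalU1R_eqOn` — two continuations of `calU1R` agree on `Re s ≥ 9/10`;
* `u056_rate1_of_relS_shape` — u056 at the rate `O(1/𝓛)` from u050, Lemma 15.2, `Lemma153Rp`, the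
  near-`1` bound, the RelS-shaped u055 (stated INLINE, by the text of the node of record) and u035;
* `u056_rate1_of_partsRelS`, `eq15_23R_of_partsRelS`, `ded1524_of_displays_RelS` — the same over the
  typed node `Typed.Section15C.Step15_u055RelS` BY NAME (the skeleton's swap target).

Theorems only. WHAT THIS IS NOT: a proof of u055 in any reading, nor any claim about Theorems 1–2 of
the manuscript or Landau–Siegel zeros.

## References
* Y. Zhang, arXiv:2211.02515v1 (2022), §15 pp. 87–88. [cite: Zhang2022LandauSiegel, §15 p.88]
-/

noncomputable section

open Complex Real ComplexConjugate Filter Topology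
open Literature.NumberTheory.LFunctions.Zhang2022.Skeleton
open Literature.NumberTheory.LFunctions.Zhang2022.Typed

namespace Literature.NumberTheory.LFunctions.Zhang2022.Typed.Section15C

/-- **Uniqueness of the continuation of `calU1R`**: two functions analytic on (a neighbourhood of
every point of) the closed half-plane `Re s ≥ 9/10` that agree with `calU1R` on `Re s > 1` agree on
the whole half-plane (identity theorem on a convex set). [cite: Zhang2022LandauSiegel, §15 Lemma 15.3 p.87] -/
theorem isCalU1R_eqOn (c' : ℝ) (X : Inputs15AB) {D : ℕ} [NeZero D] (χ : DirichletCharacter ℂ D)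
    (j : ℕ) {U V : ℂ → ℂ} (hU : IsCalU1R c' X χ j U) (hV : IsCalU1R c' X χ j V) :
    Set.EqOn U V {s : ℂ | 9 / 10 ≤ s.re} := by
  have hpre : IsPreconnected {s : ℂ | 9 / 10 ≤ s.re} :=
    (convex_halfSpace_re_ge (r := 9 / 10)).isPreconnected
  have h2 : (2 : ℂ) ∈ {s : ℂ | 9 / 10 ≤ s.re} := by
    show (9 : ℝ) / 10 ≤ (2 : ℂ).re; norm_num
  have hev : U =ᶠ[𝓝 (2 : ℂ)] V := by
    have hopen : IsOpen {s : ℂ | 1 < s.re} := isOpen_lt continuous_const Complex.continuous_re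
    have hmem : (2 : ℂ) ∈ {s : ℂ | 1 < s.re} := by
      show (1 : ℝ) < (2 : ℂ).re; norm_num
    filter_upwards [hopen.mem_nhds hmem] with s hs
    rw [hU.2 s hs, hV.2 s hs]
  exact hU.1.eqOn_of_preconnected_of_eventuallyEq hV.1 hpre h2 hev

/-- The relative reading `Step15_u055Rel` implies the amended one `Step15_u055RelS`: any admissible
`S` dominates `‖U(1)‖` (take `s = 1` in the disc hypothesis) and `𝓛^{1.1} ≤ 𝓛³` for `𝓛 ≥ 1`; hence so
does the printed absolute reading (`step15_u055Rel_of_R`). [cite: Zhang2022LandauSiegel, §15 p.87] -/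
theorem step15_u055RelS_of_Rel (c' : ℝ) (X : Inputs15AB) (h : Step15_u055Rel c' X) :
    Step15_u055RelS c' X := by
  obtain ⟨C, D₀, hC⟩ := h
  refine ⟨max C 0, max D₀ 3, fun D _ χ hD hq hp hA j hj U hU S hS1 _ => ?_⟩
  have h1 := hC D χ (le_trans (le_max_left _ _) hD) hq hp hA j hj U hU
  have hℓ : 1 ≤ ell D := one_le_ell (le_trans (le_max_right _ _) hD)
  have hℓ0 : 0 < ell D := by linarith
  have hα : 0 ≤ alpha D := alpha_nonneg D
  have hU1 : ‖U 1‖ ≤ S := hS1 1 (by simp; positivity)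
  have hS0 : 0 ≤ S := (norm_nonneg _).trans hU1
  have hpow : ell D ^ (1.1 : ℝ) ≤ ell D ^ 3 := by
    calc ell D ^ (1.1 : ℝ) ≤ ell D ^ (3 : ℝ) := Real.rpow_le_rpow_of_exponent_le hℓ (by norm_num)
      _ = ell D ^ 3 := by norm_cast
  have hX : (1 + ‖deriv χ.LFunction 1‖) ^ 2 * ‖U 1‖ + 1 ≤
      (1 + ‖deriv χ.LFunction 1‖) ^ 2 * S + 1 := by gcongr
  have hX0 : 0 ≤ (1 + ‖deriv χ.LFunction 1‖) ^ 2 * ‖U 1‖ + 1 := by positivity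
  refine h1.trans ?_
  calc C * (alpha D * ell D ^ (1.1 : ℝ)) * ((1 + ‖deriv χ.LFunction 1‖) ^ 2 * ‖U 1‖ + 1)
      ≤ max C 0 * (alpha D * ell D ^ (1.1 : ℝ)) * ((1 + ‖deriv χ.LFunction 1‖) ^ 2 * ‖U 1‖ + 1) := by
        gcongr; exact le_max_left _ _
    _ ≤ max C 0 * (alpha D * ell D ^ 3) * ((1 + ‖deriv χ.LFunction 1‖) ^ 2 * S + 1) := by
        gcongr

end Literature.NumberTheory.LFunctions.Zhang2022.Typed.Section15C

namespace Literature.NumberTheory.LFunctions.Zhang2022.Ded1524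

/-- `log D ≥ M` once `D ≥ ⌈e^M⌉`. [folklore] -/
private theorem le_ell_of_ceil_exp_le₇ {M : ℝ} {D : ℕ} (hD : ⌈Real.exp M⌉₊ ≤ D) : M ≤ ell D := by
  have h : Real.exp M ≤ D := le_trans (Nat.le_ceil _) (by exact_mod_cast hD)
  exact (Real.le_log_iff_exp_le (lt_of_lt_of_le (Real.exp_pos _) h)).mpr h

/-- `‖φ(D)²/D²‖ ≤ 1`. [folklore] -/
private theorem norm_totient_sq_div_sq_le_one₇ (D : ℕ) [NeZero D] :
    ‖(Nat.totient D : ℂ) ^ 2 / (D : ℂ) ^ 2‖ ≤ 1 := by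
  have hD0 : 0 < (D : ℝ) := by exact_mod_cast Nat.pos_of_ne_zero (NeZero.ne D)
  have hφ : (Nat.totient D : ℝ) ≤ D := by exact_mod_cast Nat.totient_le D
  rw [norm_div, norm_pow, norm_pow, Complex.norm_natCast, Complex.norm_natCast,
    div_le_one (by positivity)]
  exact pow_le_pow_left₀ (Nat.cast_nonneg _) hφ 2

/-- Bookkeeping for `‖U(1)‖`: `‖U₁ − P·e_U‖ ≤ C₃a`, `0 ≤ a ≤ π`, `‖P‖, ‖e_U‖ ≤ 1` ⇒ `‖U₁‖ ≤ 1 + |C₃|π`.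
[cite: Zhang2022LandauSiegel, §15 Lemma 15.3 p.87] -/
private theorem norm_U1_le₇ {U₁ P eU : ℂ} {C₃ a : ℝ} (h : ‖U₁ - P * eU‖ ≤ C₃ * a) (ha0 : 0 ≤ a)
    (haπ : a ≤ π) (hP : ‖P‖ ≤ 1) (heU : ‖eU‖ ≤ 1) : ‖U₁‖ ≤ 1 + |C₃| * π := by
  have h1 : ‖P * eU‖ ≤ 1 := by
    rw [norm_mul]
    calc ‖P‖ * ‖eU‖ ≤ 1 * 1 := mul_le_mul hP heU (norm_nonneg _) zero_le_one
      _ = 1 := one_mul _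
  have h2 : C₃ * a ≤ |C₃| * π :=
    (mul_le_mul_of_nonneg_right (le_abs_self C₃) ha0).trans
      (mul_le_mul_of_nonneg_left haπ (abs_nonneg _))
  calc ‖U₁‖ = ‖(U₁ - P * eU) + P * eU‖ := by rw [sub_add_cancel]
    _ ≤ ‖U₁ - P * eU‖ + ‖P * eU‖ := norm_add_le _ _
    _ ≤ |C₃| * π + 1 := add_le_add (h.trans h2) h1
    _ = 1 + |C₃| * π := by ring

/-- The arithmetic of the amended u055 error: with `α = π/𝓛⁹`, `𝓛 ≥ 1`, `L ≤ 4e^{9/2}𝓛²`,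
`0 ≤ S ≤ C_S·𝓛`: `|C₆|·(|C₄|·α𝓛³·((1+L)²S + 1)) ≤ |C₆||C₄|π((1+4e^{9/2})²C_S + 1)·(1/𝓛)`. [folklore] -/
private theorem relErrS_le {ℓ α L S C_S C₄ C₆ : ℝ} (hℓ1 : 1 ≤ ℓ) (hα : α = π / ℓ ^ 9)
    (hL : L ≤ 4 * Real.exp (9 / 2) * ℓ ^ 2) (hL0 : 0 ≤ L) (hS : S ≤ C_S * ℓ) (hS0 : 0 ≤ S) :
    |C₆| * (|C₄| * (α * ℓ ^ 3) * ((1 + L) ^ 2 * S + 1)) ≤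
      |C₆| * |C₄| * π * ((1 + 4 * Real.exp (9 / 2)) ^ 2 * C_S + 1) * (1 / ℓ) := by
  have hℓ0 : 0 < ℓ := lt_of_lt_of_le zero_lt_one hℓ1
  have hCS : 0 ≤ C_S := by
    have : 0 ≤ C_S * ℓ := hS0.trans hS
    nlinarith
  have hℓ2 : (1 : ℝ) ≤ ℓ ^ 2 := one_le_pow₀ hℓ1
  have hℓ5 : (1 : ℝ) ≤ ℓ ^ 5 := one_le_pow₀ hℓ1
  have hL1 : 1 + L ≤ (1 + 4 * Real.exp (9 / 2)) * ℓ ^ 2 := by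
    calc 1 + L ≤ ℓ ^ 2 + 4 * Real.exp (9 / 2) * ℓ ^ 2 := add_le_add hℓ2 hL
      _ = (1 + 4 * Real.exp (9 / 2)) * ℓ ^ 2 := by ring
  have h1 : (1 + L) ^ 2 ≤ (1 + 4 * Real.exp (9 / 2)) ^ 2 * ℓ ^ 4 := by
    calc (1 + L) ^ 2 ≤ ((1 + 4 * Real.exp (9 / 2)) * ℓ ^ 2) ^ 2 :=
          pow_le_pow_left₀ (by linarith) hL1 2
      _ = (1 + 4 * Real.exp (9 / 2)) ^ 2 * ℓ ^ 4 := by ring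
  have hX : (1 + L) ^ 2 * S + 1 ≤ ((1 + 4 * Real.exp (9 / 2)) ^ 2 * C_S + 1) * ℓ ^ 5 := by
    have h2 : (1 + L) ^ 2 * S ≤ (1 + 4 * Real.exp (9 / 2)) ^ 2 * ℓ ^ 4 * (C_S * ℓ) :=
      mul_le_mul h1 hS hS0 (by positivity)
    calc (1 + L) ^ 2 * S + 1 ≤ (1 + 4 * Real.exp (9 / 2)) ^ 2 * ℓ ^ 4 * (C_S * ℓ) + ℓ ^ 5 :=
          add_le_add h2 hℓ5
      _ = ((1 + 4 * Real.exp (9 / 2)) ^ 2 * C_S + 1) * ℓ ^ 5 := by ring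
  have hαpos : 0 < α := by rw [hα]; positivity
  have hcore : α * ℓ ^ 3 * ℓ ^ 5 = π * (1 / ℓ) := by rw [hα]; field_simp
  have hαℓ : 0 ≤ α * ℓ ^ 3 := by positivity
  calc |C₆| * (|C₄| * (α * ℓ ^ 3) * ((1 + L) ^ 2 * S + 1))
      ≤ |C₆| * (|C₄| * (α * ℓ ^ 3) * (((1 + 4 * Real.exp (9 / 2)) ^ 2 * C_S + 1) * ℓ ^ 5)) :=
        mul_le_mul_of_nonneg_left (mul_le_mul_of_nonneg_left hX (mul_nonneg (abs_nonneg _) hαℓ))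
          (abs_nonneg _)
    _ = |C₆| * |C₄| * ((1 + 4 * Real.exp (9 / 2)) ^ 2 * C_S + 1) * (α * ℓ ^ 3 * ℓ ^ 5) := by
        ring
    _ = |C₆| * |C₄| * π * ((1 + 4 * Real.exp (9 / 2)) ^ 2 * C_S + 1) * (1 / ℓ) := by
        rw [hcore]; ring

/-- The arithmetic of the Lemma 15.2 / u053 error terms (verbatim twin of the `RateRel` lemma):
with `α𝓛 = π/𝓛⁸ ≤ π`, `(4e^{9/2}𝓛²)²·(|C₆||C₃|α𝓛 + |C₁|α𝓛(C₂ + |C₃|α𝓛)) ≤ (4e^{9/2})²π(…)·(1/𝓛)`. [folklore] -/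
private theorem t3_le₇ {ℓ a C₁ C₂ C₃ C₆ : ℝ} (hℓ1 : 1 ≤ ℓ) (ha1 : a = π / ℓ ^ 8) (haπ : a ≤ π)
    (ha0 : 0 ≤ a) (hC₂0 : 0 ≤ C₂) :
    (4 * Real.exp (9 / 2) * ℓ ^ 2) ^ 2 *
        (|C₆| * (|C₃| * a) + |C₁| * a * (C₂ + |C₃| * a)) ≤
      (4 * Real.exp (9 / 2)) ^ 2 * π * (|C₆| * |C₃| + |C₁| * (C₂ + |C₃| * π)) * (1 / ℓ) := by
  have hℓ0 : 0 < ℓ := lt_of_lt_of_le zero_lt_one hℓ1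
  have h4 : ℓ ^ 4 * a = π * (1 / ℓ ^ 4) := by rw [ha1]; field_simp
  have i4 : 1 / ℓ ^ 4 ≤ 1 / ℓ :=
    one_div_le_one_div_of_le hℓ0 (by
      calc ℓ = ℓ ^ 1 := (pow_one _).symm
        _ ≤ ℓ ^ 4 := pow_le_pow_right₀ hℓ1 (by norm_num))
  have inner : |C₆| * (|C₃| * a) + |C₁| * a * (C₂ + |C₃| * a) ≤
      (|C₆| * |C₃| + |C₁| * (C₂ + |C₃| * π)) * a := by
    have : |C₁| * a * (|C₃| * a) ≤ |C₁| * a * (|C₃| * π) := by gcongr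
    nlinarith [abs_nonneg C₆, abs_nonneg C₃, abs_nonneg C₁, hC₂0]
  calc (4 * Real.exp (9 / 2) * ℓ ^ 2) ^ 2 * (|C₆| * (|C₃| * a) + |C₁| * a * (C₂ + |C₃| * a))
      ≤ (4 * Real.exp (9 / 2) * ℓ ^ 2) ^ 2 * ((|C₆| * |C₃| + |C₁| * (C₂ + |C₃| * π)) * a) := by
        gcongr
    _ = (4 * Real.exp (9 / 2)) ^ 2 * (|C₆| * |C₃| + |C₁| * (C₂ + |C₃| * π)) * (ℓ ^ 4 * a) := by
        ring
    _ = (4 * Real.exp (9 / 2)) ^ 2 * (|C₆| * |C₃| + |C₁| * (C₂ + |C₃| * π)) * (π * (1 / ℓ ^ 4)) := by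
        rw [h4]
    _ = (4 * Real.exp (9 / 2)) ^ 2 * π * (|C₆| * |C₃| + |C₁| * (C₂ + |C₃| * π)) * (1 / ℓ ^ 4) := by
        ring
    _ ≤ (4 * Real.exp (9 / 2)) ^ 2 * π * (|C₆| * |C₃| + |C₁| * (C₂ + |C₃| * π)) * (1 / ℓ) := by
        gcongr

/-- **u056 at the rate `O(1/𝓛)` from the AMENDED relative u055 (RelS shape, stated inline by the text
of the node of record `Step15_u055RelS`)**: inputs u050, Lemma 15.2, Lemma 15.3 in the reading of record
`Lemma153Rp` (continuation + half-plane bound `C₈e^{2𝓛^{1/10}}` + u053R), the near-`1` bound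
`‖U(s)‖ ≤ C₇𝓛` on `‖s−1‖ ≤ 1/𝓛` for SOME continuation, the RelS-shaped u055, and u035. The sup
parameter is taken as `S = max(C₇𝓛, max(C₈, 0))` after identifying the two continuations
(`isCalU1R_eqOn`; the disc `‖s−1‖ ≤ 1/𝓛` lies in `Re s ≥ 9/10` once `𝓛 ≥ 10`), and then
`|C₄|·α𝓛³·((1+|L′|)²S + 1) ≤ K₄/𝓛`. Original display (§15 p.88, tex L4363–L4365):
`𝓜₁(1,1;1−βⱼ)·Σ_{n∈𝒩(𝒬),n<T}χ(n)τ₂(n)ϖ₁ⱼ(n)/n = 𝔞φ(D)/D + O(𝓛⁻³)`; derived here with `O(1/𝓛)`.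
[cite: Zhang2022LandauSiegel, §15 p.88] -/
theorem u056_rate1_of_relS_shape (c' : ℝ)
    (h50 : Section15C.Step15_u050 c' Section15C.inputs15AB)
    (h152 : Section15C.Lemma152 c' Section15C.inputs15AB)
    (h153 : Section15C.Lemma153Rp c' Section15C.inputs15AB)
    (hnear : ∃ C₇ : ℝ, ForAllLarge fun D _ χ => AssumptionA D χ → ∀ j ∈ ({1, 2, 3} : Finset ℕ),
      ∃ U : ℂ → ℂ, Section15C.IsCalU1R c' Section15C.inputs15AB χ j U ∧
        ∀ s : ℂ, ‖s - 1‖ ≤ 1 / ell D → ‖U s‖ ≤ C₇ * ell D)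
    (h55 : ∃ C : ℝ, ForAllLarge fun D _ χ => AssumptionA D χ → ∀ j ∈ ({1, 2, 3} : Finset ℕ),
      ∀ U : ℂ → ℂ, Section15C.IsCalU1R c' Section15C.inputs15AB χ j U → ∀ S : ℝ,
        (∀ s : ℂ, ‖s - 1‖ ≤ 1 / ell D → ‖U s‖ ≤ S) →
        (∀ s : ℂ, 9 / 10 ≤ s.re → ‖U s‖ ≤ S * Real.exp (2 * ell D ^ (1 / 10 : ℝ))) →
          ‖Section15C.sumLtT c' Section15C.inputs15AB χ j - deriv χ.LFunction 1 ^ 2 * U 1‖ ≤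
            C * (alpha D * ell D ^ 3) * ((1 + ‖deriv χ.LFunction 1‖) ^ 2 * S + 1))
    (h35 : Section15B.Step15_u035 c') :
    ∃ C : ℝ, ForAllLarge fun D _ χ => AssumptionA D χ → ∀ j ∈ ({1, 2, 3} : Finset ℕ),
      ‖Section15C.inputs15AB.calM1 c' χ 1 1 (1 - betaJ c' D j) *
          Section15C.sumInN c' Section15C.inputs15AB χ j -
        (frakA χ : ℂ) * (Nat.totient D : ℂ) / (D : ℂ)‖ ≤ C / ell D := by
  obtain ⟨C₅, h50⟩ := h50
  obtain ⟨C₁, h152⟩ := h152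
  obtain ⟨⟨C₈, h153a⟩, ⟨C₃, h153b⟩⟩ := h153
  obtain ⟨C₇, hnear⟩ := hnear
  obtain ⟨C₄, h55⟩ := h55
  obtain ⟨c₆, C₆, h35⟩ := h35
  set C₂ : ℝ := 1 + |C₃| * π with hC₂
  have hC₂0 : 0 ≤ C₂ := by rw [hC₂]; positivity
  set C_S : ℝ := |C₇| + |C₈| with hCS
  set M : ℝ := max 10 (14 * |c'| * π + 1) with hM
  have hT : ForAllLarge fun D _ _ => M ≤ ell D :=
    ForAllLarge.of_le ⌈Real.exp M⌉₊ fun D _ _ hD _ _ => le_ell_of_ceil_exp_le₇ hD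
  -- the new u055 constant: `|C₆|·ε₄ ≤ K₄/𝓛`
  set K₄ : ℝ := |C₆| * |C₄| * π * ((1 + 4 * Real.exp (9 / 2)) ^ 2 * C_S + 1) with hK₄
  set K : ℝ := |C₆| * |C₅| + K₄ +
    (4 * Real.exp (9 / 2)) ^ 2 * π * (|C₆| * |C₃| + |C₁| * (C₂ + |C₃| * π)) with hK
  obtain ⟨D₀, h⟩ :=
    ((((((h50.and h152).and h153a).and h153b).and hnear).and h55).and h35).and hT
  refine ⟨K, D₀, fun D _ χ hD hq hp hA j hj => ?_⟩
  obtain ⟨⟨⟨⟨⟨⟨⟨g50, g152⟩, g153a⟩, g153b⟩, gnear⟩, g55⟩, g35⟩, hMℓ⟩ := h D χ hD hq hp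
  have hℓ10 : 10 ≤ ell D := (le_max_left _ _).trans hMℓ
  have hℓc : 14 * |c'| * π + 1 ≤ ell D := (le_max_right _ _).trans hMℓ
  have hℓ3 : 3 ≤ ell D := by linarith
  have hℓ1 : 1 ≤ ell D := by linarith
  have hℓ0 : 0 < ell D := by linarith
  have hD3 : 3 ≤ D := by
    by_contra hlt
    have : (D : ℝ) < 3 := by exact_mod_cast not_le.mp hlt
    have hD0 : 0 < (D : ℝ) := by exact_mod_cast Nat.pos_of_ne_zero (NeZero.ne D)
    have : ell D < 3 := by
      calc ell D = Real.log D := rfl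
        _ < Real.log (Real.exp 3) := Real.log_lt_log hD0 (by
            have := Real.add_one_le_exp (3:ℝ); linarith)
        _ = 3 := Real.log_exp 3
    linarith
  have hα : alpha D = π / ell D ^ 9 := by rw [alpha, bigP, Real.log_exp]
  have hαpos : 0 < alpha D := by rw [hα]; positivity
  have hα1 : alpha D * ell D = π / ell D ^ 8 := by rw [hα]; field_simp
  have hαℓle : alpha D * ell D ≤ π := by
    rw [hα1]; exact div_le_self Real.pi_pos.le (one_le_pow₀ hℓ1)
  have hθ : |c' * alpha D * ell D| ≤ 1 / 14 := by
    rw [abs_mul, abs_mul, abs_of_pos hαpos, abs_of_pos hℓ0, mul_assoc, hα1,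
      show |c'| * (π / ell D ^ 8) = |c'| * π / ell D ^ 8 by ring,
      div_le_div_iff₀ (by positivity) (by norm_num)]
    have h8 : ell D ≤ ell D ^ 8 := by
      calc ell D = ell D ^ 1 := (pow_one _).symm
        _ ≤ ell D ^ 8 := pow_le_pow_right₀ hℓ1 (by norm_num)
    nlinarith [abs_nonneg c', Real.pi_pos]
  obtain ⟨hβ5, hβre⟩ := betaJ_norm_lt c' hαpos hθ hj
  set s : ℂ := 1 - betaJ c' D j with hs
  have hs1 : ‖s - 1‖ < 5 * alpha D := by rw [hs, sub_sub_cancel_left, norm_neg]; exact hβ5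
  have hsre : 9 / 10 < s.re := by rw [hs, Complex.sub_re, Complex.one_re, hβre]; norm_num
  have e152 : ‖Section15C.inputs15AB.calM1 c' χ 1 1 s - Section15C.eulerM1 χ‖ ≤
      C₁ * (alpha D * ell D) := g152 hA s hs1
  -- the continuation `U` of Lemma 15.3 (half-plane bound) and the near-`1` one `V`; they coincide
  obtain ⟨U, hU, hUbd⟩ := g153a hA j hj
  obtain ⟨V, hV, hVbd⟩ := gnear hA j hj
  have hUV := Section15C.isCalU1R_eqOn c' Section15C.inputs15AB χ j hU hV
  set S : ℝ := max (C₇ * ell D) (max C₈ 0) with hSdef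
  have hS0 : 0 ≤ S := le_trans (le_max_right _ _) (le_max_right _ _)
  have hS1 : ∀ z : ℂ, ‖z - 1‖ ≤ 1 / ell D → ‖U z‖ ≤ S := by
    intro z hz
    have hzre : 9 / 10 ≤ z.re := by
      have h1 : |(z - 1).re| ≤ ‖z - 1‖ := Complex.abs_re_le_norm _
      have h2 : 1 / ell D ≤ 1 / 10 := one_div_le_one_div_of_le (by norm_num) hℓ10
      rw [Complex.sub_re, Complex.one_re] at h1
      have h3 := (abs_le.mp (h1.trans (hz.trans h2))).1
      linarith
    rw [hUV hzre]
    exact (hVbd z hz).trans (le_max_left _ _)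
  have hS2 : ∀ z : ℂ, 9 / 10 ≤ z.re → ‖U z‖ ≤ S * Real.exp (2 * ell D ^ (1 / 10 : ℝ)) := by
    intro z hz
    refine (hUbd z hz).trans ?_
    exact mul_le_mul_of_nonneg_right ((le_max_left _ _).trans (le_max_right _ _))
      (Real.exp_pos _).le
  have hSle : S ≤ C_S * ell D := by
    rw [hSdef, hCS]
    refine max_le ?_ (max_le ?_ ?_)
    · have : C₇ * ell D ≤ |C₇| * ell D := mul_le_mul_of_nonneg_right (le_abs_self _) hℓ0.le
      nlinarith [abs_nonneg C₈]
    · have : C₈ ≤ |C₈| * ell D := (le_abs_self _).trans (le_mul_of_one_le_right (abs_nonneg _) hℓ1)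
      nlinarith [abs_nonneg C₇]
    · positivity
  have e153b : ‖U 1 - (Nat.totient D : ℂ) ^ 2 / (D : ℂ) ^ 2 * Section15C.eulerU1 χ‖ ≤
      C₃ * (alpha D * ell D) := g153b hA j hj U hU
  have e55 : ‖Section15C.sumLtT c' Section15C.inputs15AB χ j - deriv χ.LFunction 1 ^ 2 * U 1‖ ≤
      C₄ * (alpha D * ell D ^ 3) * ((1 + ‖deriv χ.LFunction 1‖) ^ 2 * S + 1) :=
    g55 hA j hj U hU S hS1 hS2
  have e50 : ‖Section15C.sumNotInN c' Section15C.inputs15AB χ j‖ ≤ C₅ / ell D := g50 hA j hj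
  have e35 : ‖Section15C.inputs15AB.calM1 c' χ 1 1 s‖ ≤ C₆ := by
    have h := g35 hA 1 1 le_rfl le_rfl s hsre
    rw [Section15C.inputs15AB_calM1]
    simpa using h
  have hαℓ0' : 0 ≤ alpha D * ell D := mul_nonneg hαpos.le hℓ0.le
  have eU1 : ‖U 1‖ ≤ C₂ := by
    rw [hC₂]
    exact norm_U1_le₇ e153b hαℓ0' hαℓle (norm_totient_sq_div_sq_le_one₇ D)
      (norm_eulerU1_le_one χ)
  have hLup : ‖deriv χ.LFunction 1‖ ≤ 4 * Real.exp (9 / 2) * ell D ^ 2 := by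
    have h := Lemma31.norm_deriv_LFunction_le_near_one χ (by rw [ell] at hℓ3; exact hℓ3) hp
      (w := 1) (by simp; positivity)
    calc ‖deriv χ.LFunction 1‖ ≤ 2 * Real.exp (9 / 2) * (1 + Real.log D) * Real.log D := h
      _ ≤ 2 * Real.exp (9 / 2) * (ell D + ell D) * ell D := by rw [ell] at hℓ1 ⊢; gcongr
      _ = 4 * Real.exp (9 / 2) * ell D ^ 2 := by ring
  -- the amended u055 error as a number `ε₄ ≥ 0`
  set ε₄ : ℝ := |C₄| * (alpha D * ell D ^ 3) *
    ((1 + ‖deriv χ.LFunction 1‖) ^ 2 * S + 1) with hε₄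
  have hαℓ3 : 0 ≤ alpha D * ell D ^ 3 := by positivity
  have e55' : ‖Section15C.sumLtT c' Section15C.inputs15AB χ j - deriv χ.LFunction 1 ^ 2 * U 1‖ ≤
      ε₄ := e55.trans (by rw [hε₄]; gcongr; exact le_abs_self C₄)
  have hmain := mainTerm_u056 χ hp hq hD3
  have hP := u056_pointwise (ε₁ := |C₁| * (alpha D * ell D)) (ε₃ := |C₃| * (alpha D * ell D))
    (ε₄ := ε₄) (ε₅ := |C₅| / ell D) (C₂ := C₂) (C₆ := |C₆|)
    (e152.trans (by gcongr; exact le_abs_self C₁)) (e153b.trans (by gcongr; exact le_abs_self C₃))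
    e55' (e50.trans (by gcongr; exact le_abs_self C₅))
    (e35.trans (le_abs_self C₆)) eU1 hLup hmain
  have hIn : Section15C.sumInN c' Section15C.inputs15AB χ j =
      Section15C.sumLtT c' Section15C.inputs15AB χ j -
        Section15C.sumNotInN c' Section15C.inputs15AB χ j := by
    rw [sumLtT_eq]; ring
  rw [hIn]
  refine hP.trans ?_
  have t1 : |C₆| * (|C₅| / ell D) = |C₆| * |C₅| * (1 / ell D) := by ring
  -- `|C₆|·ε₄ ≤ K₄/𝓛` (the arithmetic is `relErrS_le`)
  have t2 : |C₆| * ε₄ ≤ K₄ * (1 / ell D) := by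
    rw [hε₄, hK₄]
    exact relErrS_le hℓ1 hα hLup (norm_nonneg _) hSle hS0
  have t3 := t3_le₇ (C₁ := C₁) (C₂ := C₂) (C₃ := C₃) (C₆ := C₆) hℓ1 hα1 hαℓle hαℓ0' hC₂0
  have hKd : K / ell D = K * (1 / ell D) := div_eq_mul_one_div _ _
  rw [hKd, hK]
  linarith


/-- **u056 at the rate `O(1/𝓛)` over `Lemma153Rp`, the near-`1` bound and the AMENDED relative u055
`Step15_u055RelS` BY NAME** — the one-for-one twin of `u056_rate1_of_partsRel` for the skeleton swap
`h15u055R ↦ h15u055RelS` (ruling R-34). [cite: Zhang2022LandauSiegel, §15 p.88] -/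
theorem u056_rate1_of_partsRelS (c' : ℝ) (h50 : Section15C.Step15_u050 c' Section15C.inputs15AB)
    (h152 : Section15C.Lemma152 c' Section15C.inputs15AB)
    (h153 : Section15C.Lemma153Rp c' Section15C.inputs15AB)
    (hnear : ∃ C₇ : ℝ, ForAllLarge fun D _ χ => AssumptionA D χ → ∀ j ∈ ({1, 2, 3} : Finset ℕ),
      ∃ U : ℂ → ℂ, Section15C.IsCalU1R c' Section15C.inputs15AB χ j U ∧
        ∀ s : ℂ, ‖s - 1‖ ≤ 1 / ell D → ‖U s‖ ≤ C₇ * ell D)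
    (h55 : Section15C.Step15_u055RelS c' Section15C.inputs15AB)
    (h35 : Section15B.Step15_u035 c') :
    ∃ C : ℝ, ForAllLarge fun D _ χ => AssumptionA D χ → ∀ j ∈ ({1, 2, 3} : Finset ℕ),
      ‖Section15C.inputs15AB.calM1 c' χ 1 1 (1 - betaJ c' D j) *
          Section15C.sumInN c' Section15C.inputs15AB χ j -
        (frakA χ : ℂ) * (Nat.totient D : ℂ) / (D : ℂ)‖ ≤ C / ell D :=
  u056_rate1_of_relS_shape c' h50 h152 h153 hnear h55 h35

/-- (15.23) in its repaired reading `Eq15_23R` (`O(1/𝓛)`) from (15.22), u050, Lemma 15.2,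
`Lemma153Rp`, the near-`1` bound, the AMENDED relative u055 and u035.
[cite: Zhang2022LandauSiegel, §15 (15.23) p.88] -/
theorem eq15_23R_of_partsRelS (c' : ℝ)
    (h22 : Section15C.Eq15_22 c' Section15C.inputs15AB)
    (h50 : Section15C.Step15_u050 c' Section15C.inputs15AB)
    (h152 : Section15C.Lemma152 c' Section15C.inputs15AB)
    (h153 : Section15C.Lemma153Rp c' Section15C.inputs15AB)
    (hnear : ∃ C₇ : ℝ, ForAllLarge fun D _ χ => AssumptionA D χ → ∀ j ∈ ({1, 2, 3} : Finset ℕ),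
      ∃ U : ℂ → ℂ, Section15C.IsCalU1R c' Section15C.inputs15AB χ j U ∧
        ∀ s : ℂ, ‖s - 1‖ ≤ 1 / ell D → ‖U s‖ ≤ C₇ * ell D)
    (h55 : Section15C.Step15_u055RelS c' Section15C.inputs15AB)
    (h35 : Section15B.Step15_u035 c') : Section15C.Eq15_23R c' Section15C.inputs15AB :=
  eq15_23R_of_eq15_22_rate1 c' _ h22 (u056_rate1_of_partsRelS c' h50 h152 h153 hnear h55 h35)

/-- **(15.24) / `Skeleton.Ded1524 c′` — display list over the dischargeable readings with the
AMENDED relative u055**: (15.6), (15.17), (15.22), u050, Lemma 15.2, `Lemma153RpI`, the near-`1`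
bound, u055RelS, u035, u058, u059. [cite: Zhang2022LandauSiegel, §15 (15.24) p.88] -/
theorem ded1524_of_displays_RelS (c' : ℝ) (h6 : Section15A.Eq15_6 c' Section15A.bLit)
    (h17 : Section15B.Eq15_17 c' Section15A.bLit)
    (h22 : Section15C.Eq15_22 c' Section15C.inputs15AB)
    (h50 : Section15C.Step15_u050 c' Section15C.inputs15AB)
    (h152 : Section15C.Lemma152 c' Section15C.inputs15AB)
    (h153 : Section15C.Lemma153RpI c')
    (hnear : ∃ C₇ : ℝ, ForAllLarge fun D _ χ => AssumptionA D χ → ∀ j ∈ ({1, 2, 3} : Finset ℕ),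
      ∃ U : ℂ → ℂ, Section15C.IsCalU1R c' Section15C.inputs15AB χ j U ∧
        ∀ s : ℂ, ‖s - 1‖ ≤ 1 / ell D → ‖U s‖ ≤ C₇ * ell D)
    (h55 : Section15C.Step15_u055RelS c' Section15C.inputs15AB)
    (h35 : Section15B.Step15_u035 c')
    (h58 : Section15C.Step15_u058 c' Section15C.inputs15AB)
    (h59 : Section15C.Step15_u059 c' Section15C.inputs15AB) : Ded1524 c' :=
  fun _ _ _ _ => eval1524_of_rates_R
    (Φp := fun D _ χ p => Section15A.Phi1pOf c' χ (Section15A.bLit D χ) p)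
    (S := fun D _ χ j => Section15B.calS1 c' χ (Section15A.bLit D χ) j)
    (R := fun _ _ χ j => Section15B.calR1 c' χ j)
    (Rs := fun _ _ χ => Section15A.calR1star c' χ)
    h6 h17 (eq15_23R_of_partsRelS c' h22 h50 h152 h153 hnear h55 h35)
    (prod_rate5_of_values c' h58 h59)

end Literature.NumberTheory.LFunctions.Zhang2022.Ded1524
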